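import Literature.AnabelianGeometry.EtaleTheta.EtaleThetaClass
import Literature.AnabelianGeometry.EtaleTheta.SettingModelKummerDataEmpty
import HarnessLib

/-!
# [EtTh] Prop. 1.3 / Rmk. 1.3.1 as typed (`ThetaSetting.Prop13`, `ThetaSetting.Rmk131`): SCHEMATA over the
# abstract étale-theta data — kernel truth table (FACT-LIST rows F-2492, F-0523; proof-only companion)

Mochizuki, *The étale theta function …*, Publ. RIMS **45** (2009) [EtTh], §1, Prop. 1.3 "(The Étale Theta Class)",
PRIMS PDF pp. 19–21 (printed 245–247) [cite: MochizukiEtTh2009, Prop 1.3 p.20]: "… a cohomology class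
`η^Θ_N ∈ H¹(Π^tp_Y, (½ℤ/Nℤ)(1))` … arises from a cohomology class `∈ H¹(Π^tp_Y/Π^tp_{Z̈_N}, …)` … by allowing `N`
to vary … `O^×_{K/K̈} · η^Θ ∈ H¹(Π^tp_Y, ½Δ_Θ)` … the restricted classes … arise naturally from classes
`O^×_K̈ · η̈^Θ ∈ H¹(Π^tp_Ÿ, Δ_Θ)` … 'without denominators'"; Rmk. 1.3.1 p. 21: "the denominators `½` in
Proposition 1.3 are by no means superfluous".

PROOF-ONLY file (abc-iut cell, block F fact-proving wave, seat abc-iut-f-117, tranche 117; FACT-LIST rows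
**F-2492** `Literature.AnabelianGeometry.EtaleTheta.ThetaSetting.Prop13` and **F-0523**
`Literature.AnabelianGeometry.EtaleTheta.ThetaSetting.Rmk131`, both kernel_closedness = parametrised).
abc-iut-L2-t1's interface `ThetaSetting.EtaleThetaData D` (`EtaleThetaClass.lean`) extends the Kummer data
`ThetaSetting.KummerData D` by ONE genuine class `η̈^Θ ∈ H¹(Π^tp_Ÿ, Δ_Θ)` (real `ContH1`) and by ABSTRACT groups
`H¹(Π^tp_Y, Δ_Θ ⊗ ½ℤ/Nℤ)`, `H¹(Π^tp_Y, ½Δ_Θ)`, `H¹(Π^tp_Ÿ, ½Δ_Θ)`, `H¹(Π^tp_{Z̈_N}, …)` with elements `η^Θ_N`, `η^Θ` and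
connecting homomorphisms, constrained by the single square `resHalf_ofIntegralY`; `Prop13 E` / `Rmk131 E` are
predicates on these data.  Since the abstract fields are FREE, the kernel truth table is (plan header rule R1):

* **relative independence** — for EVERY theta setting `D` and EVERY Kummer datum `K : D.KummerData`, all four
  truth-value combinations of (`Prop13`, `Rmk131`) are realised by étale-theta data over `K`
  (`KummerData.exists_etaleThetaData_prop13_iff_rmk131_iff`: all abstract groups `ℤ`, all connecting maps trivial,
  `η^Θ_N := eN`, `η^Θ := e`; then `Prop13 ↔ eN = 1` and `Rmk131 ↔ e ≠ 1`); in particular Prop. 1.3 ∧ Rmk. 1.3.1 as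
  typed are JOINTLY SATISFIABLE over any Kummer datum (`exists_etaleThetaData_prop13_and_rmk131`) and EACH is
  refutable over any Kummer datum (`exists_etaleThetaData_not_prop13`, `exists_etaleThetaData_not_rmk131`);
* **exact reduction of the universal closures** — `forall_prop13_iff_isEmpty_kummerData`:
  `(∀ E : D.EtaleThetaData, Prop13 E) ↔ IsEmpty D.KummerData`, and `forall_rmk131_iff_isEmpty_kummerData` likewise;
  hence the FULL closures over all `p`, `D`, `E` hold iff NO theta setting carries Kummer data
  (`forall_prop13_iff_forall_isEmpty_kummerData`, `forall_rmk131_iff_forall_isEmpty_kummerData`) — i.e. they are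
  SCHEMA rows: refuted the moment a genuine Kummer model (non-trivial cyclotomic action; abc-iut-L2-lead R77,
  GAP-LEDGER G-L2t1-1 lineage) is constructed, which [EtTh] requires;
* **vacuous truth at the tree's root model** — `model_forall_prop13`, `model_forall_rmk131`: at abc-iut-L2-t1's
  `ThetaSetting.model p` the étale-theta data are EMPTY (abc-iut-w5-d171, `ThetaSetting.model_isEmpty_etaleThetaData`:
  `−1 ∈ ℚ_p^×` cannot inject into a `2`-torsion-free `H¹`), so both closures restricted to the model hold vacuously
  and the model neither witnesses nor refutes them.

CONSUMERS: no declaration of the tree takes `Prop13` or `Rmk131` as a hypothesis (grep 2026-08-26: only the index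
`Summits/ABC/IUTFork/DAGL2p.lean`); the Kummer-level content of Prop. 1.3 that the cone uses is `ThetaCohomology.Prop15iii`
/ `etaDd_mem_thetaClasses`.  HONEST FRAMING: statements about the TYPED predicates over abstract data; the printed
Prop. 1.3 / Rmk. 1.3.1 are theorems about formal-scheme divisors on `Ÿ` and are neither asserted nor denied here;
no side is taken on [IUTchIII] Cor. 3.12; typed ≠ proved.  No definitions, no instances, no Prop facts.
-/

noncomputable section

namespace Literature.AnabelianGeometry.EtaleTheta

open Literature.AnabelianGeometry.SemiGraphs

namespace ThetaSetting

variable {p : ℕ} [Fact p.Prime] {D : ThetaSetting p}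

/-! ### Relative witnesses over an arbitrary Kummer datum -/

namespace KummerData

/-- **The abstract fields of `EtaleThetaData` are free**: over ANY Kummer datum `K`, taking every abstract
cohomology group to be `ℤ`, every connecting homomorphism trivial, `η̈^Θ := 1`, `η^Θ_N := eN`, `η^Θ := e` gives
étale-theta data `E` over `K` with `Prop13 E ↔ eN = 1` (only "`η^Θ_N` is the image of `η^Θ`" constrains) and
`Rmk131 E ↔ e ≠ 1` ("`η^Θ` is not integral up to units"). [cite: MochizukiEtTh2009, Prop 1.3 p.20] -/
theorem exists_etaleThetaData_prop13_iff_rmk131_iff (K : D.KummerData) (eN e : Multiplicative ℤ) :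
    ∃ E : D.EtaleThetaData, E.toKummerData = K ∧ (Prop13 E ↔ eN = 1) ∧ (Rmk131 E ↔ e ≠ 1) := by
  refine ⟨{ toKummerData := K
            etaDd := 1
            H1YhalfN := fun _ => Multiplicative ℤ
            etaN := fun _ => eN
            kumN := fun _ => 1
            H1Yhalf := Multiplicative ℤ
            eta := e
            toLevel := fun _ => 1
            kumHalf := 1
            ofIntegralY := 1
            H1YddHalf := Multiplicative ℤ
            resHalf := 1
            ofIntegral := 1
            resHalf_ofIntegralY := fun _ => rfl
            H1ZddN := fun _ => Multiplicative ℤ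
            resZN := fun _ => 1 }, rfl, ⟨fun h => ?_, fun h => ?_⟩, ⟨fun h => ?_, fun h _ _ => ?_⟩⟩
  · -- `Prop13 → eN = 1`: the clause `toLevel_eta` at `N = 1` reads `1 = eN`
    have h1 : (1 : Multiplicative ℤ) = eN := h.toLevel_eta 1
    exact h1.symm
  · -- `eN = 1 → Prop13`
    subst h
    exact
      { toLevel_eta := fun _ => rfl
        toLevel_kum := fun _ _ => rfl
        eta_res_Ydd := ⟨1, ⟨1, one_mem _, (one_mul _).symm⟩, rfl⟩
        resZN_etaN := fun _ => rfl }
  · -- `Rmk131 → e ≠ 1`: apply to the unit `1` and the class `1`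
    intro he
    apply h 1 1
    show (1 : Multiplicative ℤ) * e = 1
    rw [he, one_mul]
  · -- `e ≠ 1 → Rmk131`
    show (1 : Multiplicative ℤ) * e ≠ 1
    rwa [one_mul]

/-- **Prop. 1.3 ∧ Rmk. 1.3.1 as typed are jointly satisfiable over any Kummer datum** (`η^Θ_N := 1`, `η^Θ := ` a
generator of `ℤ`). [cite: MochizukiEtTh2009, Prop 1.3 p.20] -/
theorem exists_etaleThetaData_prop13_and_rmk131 (K : D.KummerData) :
    ∃ E : D.EtaleThetaData, E.toKummerData = K ∧ Prop13 E ∧ Rmk131 E := by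
  obtain ⟨E, hE, h13, h131⟩ :=
    K.exists_etaleThetaData_prop13_iff_rmk131_iff 1 (Multiplicative.ofAdd 1)
  exact ⟨E, hE, h13.mpr rfl, h131.mpr (by decide)⟩

/-- **Prop. 1.3 as typed is refutable over any Kummer datum** (`η^Θ_N := ` a generator, `η^Θ ↦ 1` at every level),
with Rmk. 1.3.1 holding. [cite: MochizukiEtTh2009, Prop 1.3 p.20] -/
theorem exists_etaleThetaData_not_prop13 (K : D.KummerData) :
    ∃ E : D.EtaleThetaData, E.toKummerData = K ∧ ¬ Prop13 E ∧ Rmk131 E := by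
  obtain ⟨E, hE, h13, h131⟩ :=
    K.exists_etaleThetaData_prop13_iff_rmk131_iff (Multiplicative.ofAdd 1) (Multiplicative.ofAdd 1)
  exact ⟨E, hE, fun h => absurd (h13.mp h) (by decide), h131.mpr (by decide)⟩

/-- **Rmk. 1.3.1 as typed is refutable over any Kummer datum** (`η^Θ := 1` IS integral), with Prop. 1.3 holding.
[cite: MochizukiEtTh2009, Rmk 1.3.1 p.21] -/
theorem exists_etaleThetaData_not_rmk131 (K : D.KummerData) :
    ∃ E : D.EtaleThetaData, E.toKummerData = K ∧ Prop13 E ∧ ¬ Rmk131 E := by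
  obtain ⟨E, hE, h13, h131⟩ := K.exists_etaleThetaData_prop13_iff_rmk131_iff 1 1
  exact ⟨E, hE, h13.mpr rfl, fun h => h131.mp h rfl⟩

/-- Both typed predicates fail simultaneously over any Kummer datum, too (fourth combination).
[cite: MochizukiEtTh2009, Prop 1.3 p.20] -/
theorem exists_etaleThetaData_not_prop13_not_rmk131 (K : D.KummerData) :
    ∃ E : D.EtaleThetaData, E.toKummerData = K ∧ ¬ Prop13 E ∧ ¬ Rmk131 E := by
  obtain ⟨E, hE, h13, h131⟩ := K.exists_etaleThetaData_prop13_iff_rmk131_iff (Multiplicative.ofAdd 1) 1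
  exact ⟨E, hE, fun h => absurd (h13.mp h) (by decide), fun h => h131.mp h rfl⟩

end KummerData

/-! ### Exact reduction of the universal closures to the (non-)existence of Kummer data -/

variable (D)

/-- **F-2492, exact reduction**: Prop. 1.3 as typed holds for ALL étale-theta data over `D` iff `D` carries NO
Kummer data (then vacuously; otherwise `exists_etaleThetaData_not_prop13` refutes it).
[cite: MochizukiEtTh2009, Prop 1.3 p.20] -/
theorem forall_prop13_iff_isEmpty_kummerData :
    (∀ E : D.EtaleThetaData, Prop13 E) ↔ IsEmpty D.KummerData := by
  refine ⟨fun h => ⟨fun K => ?_⟩, fun h E => (h.false E.toKummerData).elim⟩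
  obtain ⟨E, -, h13, -⟩ := K.exists_etaleThetaData_not_prop13
  exact h13 (h E)

/-- **F-0523, exact reduction**: Rmk. 1.3.1 as typed holds for ALL étale-theta data over `D` iff `D` carries NO
Kummer data. [cite: MochizukiEtTh2009, Rmk 1.3.1 p.21] -/
theorem forall_rmk131_iff_isEmpty_kummerData :
    (∀ E : D.EtaleThetaData, Rmk131 E) ↔ IsEmpty D.KummerData := by
  refine ⟨fun h => ⟨fun K => ?_⟩, fun h E => (h.false E.toKummerData).elim⟩
  obtain ⟨E, -, -, h131⟩ := K.exists_etaleThetaData_not_rmk131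
  exact h131 (h E)

/-- Dually: some étale-theta datum over `D` violates Prop. 1.3 as typed iff `D` carries Kummer data.
[cite: MochizukiEtTh2009, Prop 1.3 p.20] -/
theorem exists_not_prop13_iff_nonempty_kummerData :
    (∃ E : D.EtaleThetaData, ¬ Prop13 E) ↔ Nonempty D.KummerData := by
  refine ⟨fun ⟨E, _⟩ => ⟨E.toKummerData⟩, fun ⟨K⟩ => ?_⟩
  obtain ⟨E, -, h13, -⟩ := K.exists_etaleThetaData_not_prop13
  exact ⟨E, h13⟩

/-- Dually: some étale-theta datum over `D` violates Rmk. 1.3.1 as typed iff `D` carries Kummer data.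
[cite: MochizukiEtTh2009, Rmk 1.3.1 p.21] -/
theorem exists_not_rmk131_iff_nonempty_kummerData :
    (∃ E : D.EtaleThetaData, ¬ Rmk131 E) ↔ Nonempty D.KummerData := by
  refine ⟨fun ⟨E, _⟩ => ⟨E.toKummerData⟩, fun ⟨K⟩ => ?_⟩
  obtain ⟨E, -, -, h131⟩ := K.exists_etaleThetaData_not_rmk131
  exact ⟨E, h131⟩

/-- And some étale-theta datum over `D` SATISFIES Prop. 1.3 ∧ Rmk. 1.3.1 as typed iff `D` carries Kummer data
(non-vacuity is exactly the existence of a Kummer datum). [cite: MochizukiEtTh2009, Prop 1.3 p.20] -/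
theorem exists_prop13_and_rmk131_iff_nonempty_kummerData :
    (∃ E : D.EtaleThetaData, Prop13 E ∧ Rmk131 E) ↔ Nonempty D.KummerData := by
  refine ⟨fun ⟨E, _⟩ => ⟨E.toKummerData⟩, fun ⟨K⟩ => ?_⟩
  obtain ⟨E, -, h13, h131⟩ := K.exists_etaleThetaData_prop13_and_rmk131
  exact ⟨E, h13, h131⟩

variable {D}

/-- **F-2492, the universal closure over everything**: Prop. 1.3 as typed holds for all primes, all theta
settings and all étale-theta data iff NO theta setting carries Kummer data — a SCHEMA row, decided negatively
by the first genuine Kummer model. [cite: MochizukiEtTh2009, Prop 1.3 p.20] -/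
theorem forall_prop13_iff_forall_isEmpty_kummerData :
    (∀ (p : ℕ) [Fact p.Prime] (D : ThetaSetting p) (E : D.EtaleThetaData), Prop13 E) ↔
      ∀ (p : ℕ) [Fact p.Prime] (D : ThetaSetting p), IsEmpty D.KummerData :=
  ⟨fun h p _ D => (forall_prop13_iff_isEmpty_kummerData D).mp (h p D),
    fun h p _ D => (forall_prop13_iff_isEmpty_kummerData D).mpr (h p D)⟩

/-- **F-0523, the universal closure over everything**: Rmk. 1.3.1 as typed holds for all primes, all theta
settings and all étale-theta data iff NO theta setting carries Kummer data.
[cite: MochizukiEtTh2009, Rmk 1.3.1 p.21] -/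
theorem forall_rmk131_iff_forall_isEmpty_kummerData :
    (∀ (p : ℕ) [Fact p.Prime] (D : ThetaSetting p) (E : D.EtaleThetaData), Rmk131 E) ↔
      ∀ (p : ℕ) [Fact p.Prime] (D : ThetaSetting p), IsEmpty D.KummerData :=
  ⟨fun h p _ D => (forall_rmk131_iff_isEmpty_kummerData D).mp (h p D),
    fun h p _ D => (forall_rmk131_iff_isEmpty_kummerData D).mpr (h p D)⟩

/-- The two closures are therefore EQUIVALENT to each other (both say "no Kummer data anywhere").
[cite: MochizukiEtTh2009, Prop 1.3 p.20] -/
theorem forall_prop13_iff_forall_rmk131 :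
    (∀ (p : ℕ) [Fact p.Prime] (D : ThetaSetting p) (E : D.EtaleThetaData), Prop13 E) ↔
      ∀ (p : ℕ) [Fact p.Prime] (D : ThetaSetting p) (E : D.EtaleThetaData), Rmk131 E :=
  forall_prop13_iff_forall_isEmpty_kummerData.trans forall_rmk131_iff_forall_isEmpty_kummerData.symm

/-! ### The tree's root model: both closures hold vacuously -/

/-- **At the root model Prop. 1.3 as typed holds for every étale-theta datum — vacuously** (there is none:
`ThetaSetting.model_isEmpty_etaleThetaData`). [cite: MochizukiEtTh2009, Prop 1.3 p.20] -/
theorem model_forall_prop13 (p : ℕ) [Fact p.Prime] :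
    ∀ E : (ThetaSetting.model p).EtaleThetaData, Prop13 E :=
  (forall_prop13_iff_isEmpty_kummerData _).mpr (ThetaSetting.model_isEmpty_kummerData p)

/-- **At the root model Rmk. 1.3.1 as typed holds for every étale-theta datum — vacuously.**
[cite: MochizukiEtTh2009, Rmk 1.3.1 p.21] -/
theorem model_forall_rmk131 (p : ℕ) [Fact p.Prime] :
    ∀ E : (ThetaSetting.model p).EtaleThetaData, Rmk131 E :=
  (forall_rmk131_iff_isEmpty_kummerData _).mpr (ThetaSetting.model_isEmpty_kummerData p)

/-- … and at the root model NO étale-theta datum witnesses Prop. 1.3 ∧ Rmk. 1.3.1 (the model neither witnesses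
nor refutes the rows). [cite: MochizukiEtTh2009, Prop 1.3 p.20] -/
theorem model_not_exists_prop13_and_rmk131 (p : ℕ) [Fact p.Prime] :
    ¬ ∃ E : (ThetaSetting.model p).EtaleThetaData, Prop13 E ∧ Rmk131 E := by
  rw [exists_prop13_and_rmk131_iff_nonempty_kummerData]
  exact ThetaSetting.model_not_nonempty_kummerData p

end ThetaSetting

end Literature.AnabelianGeometry.EtaleTheta

end
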